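import Summits.CriticalPhenomena.Ising3D.Control2DVertexAlgebra
import Mathlib.Tactic
import HarnessLib

/-!
# The 2D Ising witness, I: the three-term action of the BPZ operator on `sl(2)` blocks
(cell `pub-ising3x`, seat controls-1 gen 37; NON-VACUITY of the 2D control's `A2D′` classes AT the
control's column `Δ_σ = 1/8` by the Ising datum itself, step 1 — CONTROL-ONLY)

HONEST FRAMING: lottery ticket; floor = tightest certified 3D Ising CFT bounds; no exact-solution
claim without a proof. CONTROL-ONLY (`d = 2`); nothing numerical is asserted here.

Every class-1 / `c` / `λ²` statement of the 2D control (`TwoSided (1/8) 2 1 …`, `CTwoSided (1/8) 2 1 …`,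
`PBoxTwoSided (1/8) 2 1 …`) quantifies over `CrossingData` at `Δ_σ = 1/8` satisfying `A2D′` with
`(G, δ) = (2, 1)`: scalars in `{x} ∪ [2, ∞)`, spin 2 in `{2} ∪ [3, ∞)`. Neither the generalised free field
(`Control2DNonVacuity`) nor the free boson (`Control2DVertexData`) inhabits it at `s = 1/8`; its natural
witness is the 2D Ising four-point function `⟨σσσσ⟩` (Belavin–Polyakov–Zamolodchikov 1984),
`g(z,z̄) = f₁(z) f₁(z̄) + f₂(z) f₂(z̄)`, `f₁(x) = (1-x)^{-1/8} (√(1+√x) + √(1-√x))/2`,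
`f₂(x) = (1-x)^{-1/8} (√(1+√x) - √(1-√x))/2` (the `c = 1/2` Virasoro blocks of `𝟙` and `ε`). Its
quasi-primary coefficients `f₁ = Σ_j A_j k_{4j}`, `f₂ = Σ_j B_j k_{4j+1}` have NO closed form (two
quasi-primaries at level 8 of the vacuum module: `A_4 = 15527/(2²⁷·3·11·13)`), so the chain
`Control2DIsing*` proves positivity STRUCTURALLY: `f₁`, `f₂` both solve `𝓑 f = 0`,
`𝓑 = θ(θ - 1/2) - x θ (2θ - 1/4) + x² (θ - 1/8)(θ + 3/8)` (`θ = x d/dx`; `𝓑` is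
`x (1-x)^{-1/8} ∘ [hypergeometric operator of ₂F₁(1/4,-1/4;1/2;·)] ∘ (1-x)^{1/8}`), and — the content of
THIS file — `𝓑` acts on the chiral blocks `k_{2h}(x) = x^h ₂F₁(h,h;2h;x)` by a THREE-TERM rule
`8 · 𝓑 k_{2h} = x² ( M₊(h) k_{2h+4} + M₀(h) k_{2h} + M₋(h) k_{2h-4} )`
(`𝓑 = x² (2D² - yD - 3/8)/8`, `y = 2/x - 1`, `D = -2(1-x) d/dx`; `k_{2h} ∝ Q_{h-1}(y)`, Legendre functions
of the second kind, on which `y` and `D` act tridiagonally — the odd shifts cancel). Hence the block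
coefficients of a solution of `𝓑 f = 0` obey a three-term recursion (`Control2DIsingRecursion`), whose
solutions are positive by a barrier induction (`Control2DIsingPositivity`).

Here: `isingMplus/ isingMzero/ isingMminus`; `blockRes h M` = the coefficient of `x^{h+M}` in `𝓑 k_{2h}`
(`k_{2h} = Σ_m κ_h(m) x^{h+m}`, `κ = chiralCoeff`); `shiftCoeff` (a coefficient shifted, extended by
zero); the identity COEFFICIENTWISE: `blockRes_three_term` (every real `h ≥ 2`), `blockRes_three_term_zero`
(`h = 0`, `k_0 = 1`) and the resonant `blockRes_three_term_half` (`h = 1/2`: `8 𝓑 k_1 = -(9/1024) x² k_5`).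
Finite algebra only (Pochhammer ratios); every identity was pre-checked in exact rational arithmetic
(HOME/pub-ising3x-controls-1/KP22/sym/).

References: A. A. Belavin, A. M. Polyakov, A. B. Zamolodchikov, Nucl. Phys. B 241 (1984) 333, §5 and
App. E (the `c = 1/2` four-point function and its differential equation)
[cite: BelavinPolyakovZamolodchikov1984, App. E]; F. A. Dolan, H. Osborn, arXiv:1108.6194, §2
eq. (2.11) (the `sl(2)` Casimir, `κ_h`) [cite: DolanOsborn2011, §2 eq. (2.11)]. Tree: `chiralCoeff`,
`chiralCoeff_eq_poch`, `chiralCoeff_succ_rec`, `chiralCoeff_one_right`, `poch` + lemmas.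
-/

namespace Summit.CriticalPhenomena.Ising3D.Control2D

open Finset
open Literature.MathematicalPhysics.QuantumFieldTheory.ConformalBootstrap3D

/-! ### Pochhammer and block-coefficient bookkeeping -/

/-- `κ_0(n+1) = 0`: the constant block `k_0 = 1` has no higher coefficients (in the tree's conventions
`(0)_{n+1} = 0` sits in numerator and denominator, and `0/0 = 0`). [folklore] -/
theorem chiralCoeff_zero_left_succ (n : ℕ) : chiralCoeff 0 (n + 1) = 0 := by
  rw [chiralCoeff_eq_poch, poch_succ_left]
  simp

/-- `κ_h(1) = h/2` for every `h ≥ 0` (at `h = 0` both sides vanish). [folklore] -/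
theorem chiralCoeff_one_right' {h : ℝ} (hh : 0 ≤ h) : chiralCoeff h 1 = h / 2 := by
  rcases hh.lt_or_eq with hpos | hzero
  · exact chiralCoeff_one_right hpos
  · rw [← hzero]
    have := chiralCoeff_zero_left_succ 0
    norm_num at this ⊢
    exact this

/-- The hypergeometric ratio solved for the next coefficient:
`κ_h(n+1) = κ_h(n) (h+n)² / ((n+1)(2h+n))` (`h > 0`). [cite: DolanOsborn2011, §2 eq. (2.11)] -/
theorem chiralCoeff_succ_ratio {h : ℝ} (hh : 0 < h) (n : ℕ) :
    chiralCoeff h (n + 1) = chiralCoeff h n * ((h + n) ^ 2 / (((n : ℝ) + 1) * (2 * h + n))) := by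
  have h1 := chiralCoeff_succ_rec hh n
  have h2 : ((n : ℝ) + 1) * (2 * h + n) ≠ 0 := by positivity
  field_simp
  linarith [h1]

/-- `κ_h(2) = h (h+1)² / (4 (2h+1))` for `h ≥ 0`. [folklore] -/
theorem chiralCoeff_two_right {h : ℝ} (hh : 0 ≤ h) :
    chiralCoeff h 2 = h * (h + 1) ^ 2 / (4 * (2 * h + 1)) := by
  rcases hh.lt_or_eq with hpos | hzero
  · rw [show chiralCoeff h 2 = chiralCoeff h (1 + 1) from rfl, chiralCoeff_succ_ratio hpos 1,
      chiralCoeff_one_right hpos]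
    have : (2 * h + 1) ≠ 0 := by positivity
    push_cast
    field_simp
    ring
  · rw [← hzero]
    have := chiralCoeff_zero_left_succ 1
    norm_num at this ⊢
    exact this

/-- `κ_h(3) = h (h+1) (h+2)² / (24 (2h+1))` for `h ≥ 0`. [folklore] -/
theorem chiralCoeff_three_right {h : ℝ} (hh : 0 ≤ h) :
    chiralCoeff h 3 = h * (h + 1) * (h + 2) ^ 2 / (24 * (2 * h + 1)) := by
  rcases hh.lt_or_eq with hpos | hzero
  · rw [show chiralCoeff h 3 = chiralCoeff h (2 + 1) from rfl, chiralCoeff_succ_ratio hpos 2,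
      chiralCoeff_two_right hh]
    have : (2 * h + 1) ≠ 0 := by positivity
    have : (2 * h + 2) ≠ 0 := by positivity
    have : (h + 1) ≠ 0 := by positivity
    push_cast
    field_simp
    ring
  · rw [← hzero]
    have := chiralCoeff_zero_left_succ 2
    norm_num at this ⊢
    exact this

/-- Shift of the base by two: `(x+2)_m · x(x+1) = (x)_m · (x+m)(x+m+1)`. [folklore] -/
theorem poch_base_add_two (x : ℝ) (m : ℕ) :
    poch (x + 2) m * (x * (x + 1)) = poch x m * ((x + m) * (x + m + 1)) := by
  induction m with
  | zero => simp
  | succ m ih =>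
    rw [poch_succ, poch_succ]
    push_cast
    linear_combination (x + m + 2) * ih

/-- **Two-step shift of the weight**:
`κ_{h+2}(m) · h(h+1)(2h+m+2)(2h+m+3) = κ_h(m+2) · 4(m+1)(m+2)(2h+1)(2h+3)` (`h > 0`). [folklore] -/
theorem chiralCoeff_shift_two {h : ℝ} (hh : 0 < h) (m : ℕ) :
    chiralCoeff (h + 2) m * (h * (h + 1) * (2 * h + m + 2) * (2 * h + m + 3)) =
      chiralCoeff h (m + 2) * (4 * ((m : ℝ) + 1) * ((m : ℝ) + 2) * (2 * h + 1) * (2 * h + 3)) := by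
  rw [chiralCoeff_eq_poch, chiralCoeff_eq_poch]
  have e1 : poch h (m + 2) = h * (h + 1) * poch (h + 2) m := by
    rw [poch_succ_left, poch_succ_left, show h + 1 + 1 = h + 2 by ring]; ring
  have e2 : poch (2 * h) (m + 2) = 2 * h * (2 * h + 1) * poch (2 * h + 2) m := by
    rw [poch_succ_left, poch_succ_left, show 2 * h + 1 + 1 = 2 * h + 2 by ring]; ring
  have e3 : poch (2 * (h + 2)) m * ((2 * h + 2) * (2 * h + 3)) =
      poch (2 * h + 2) m * ((2 * h + 2 + m) * (2 * h + 2 + m + 1)) := by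
    have := poch_base_add_two (2 * h + 2) m
    rw [show 2 * h + 2 + 2 = 2 * (h + 2) by ring, show 2 * h + 2 + 1 = 2 * h + 3 by ring] at this
    exact this
  have e4 : ((m + 2).factorial : ℝ) = (m.factorial : ℝ) * ((m : ℝ) + 1) * ((m : ℝ) + 2) := by
    rw [Nat.factorial_succ, Nat.factorial_succ]; push_cast; ring
  have hP : 0 < poch (h + 2) m := poch_pos (by linarith) m
  have hQ : 0 < poch (2 * h + 2) m := poch_pos (by linarith) m
  have hQ' : 0 < poch (2 * (h + 2)) m := poch_pos (by linarith) m
  have hF : (0 : ℝ) < m.factorial := by positivity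
  have e3' : poch (2 * (h + 2)) m =
      poch (2 * h + 2) m * ((2 * h + 2 + m) * (2 * h + 2 + m + 1)) / ((2 * h + 2) * (2 * h + 3)) := by
    rw [eq_div_iff (by positivity)]
    exact e3
  rw [e1, e2, e4, e3']
  field_simp
  ring

/-! ### The three-term coefficients and the `𝓑`-residual of a block -/

/-- `M₊(h) = (h-1) h² (h+1)² / (4 (2h+1)² (2h+3))`: the coefficient of `x² k_{2h+4}` in `8 𝓑 k_{2h}`.
[cite: BelavinPolyakovZamolodchikov1984, App. E] -/
noncomputable def isingMplus (h : ℝ) : ℝ :=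
  (h - 1) * h ^ 2 * (h + 1) ^ 2 / (4 * (2 * h + 1) ^ 2 * (2 * h + 3))

/-- `M₀(h) = -(2h+3)(h-1)h²/((2h-1)(2h+1)) - h(2h-5)(h-1)²/((2h-3)(2h-1)) - 3/8`: the coefficient of
`x² k_{2h}` in `8 𝓑 k_{2h}`. [cite: BelavinPolyakovZamolodchikov1984, App. E] -/
noncomputable def isingMzero (h : ℝ) : ℝ :=
  -((2 * h + 3) * (h - 1) * h ^ 2 / ((2 * h - 1) * (2 * h + 1)))
    - h * (2 * h - 5) * (h - 1) ^ 2 / ((2 * h - 3) * (2 * h - 1)) - 3 / 8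

/-- `M₋(h) = 4h(2h-1)`: the coefficient of `x² k_{2h-4}` in `8 𝓑 k_{2h}` (the leading one).
[cite: BelavinPolyakovZamolodchikov1984, App. E] -/
noncomputable def isingMminus (h : ℝ) : ℝ := 4 * h * (2 * h - 1)

/-- `M₊(0) = 0`. [folklore] -/
@[simp] theorem isingMplus_zero : isingMplus 0 = 0 := by simp [isingMplus]
/-- `M₋(0) = 0`. [folklore] -/
@[simp] theorem isingMminus_zero : isingMminus 0 = 0 := by simp [isingMminus]
/-- `M₀(0) = -3/8` (`8 𝓑 1 = -(3/8) x²`). [folklore] -/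
theorem isingMzero_zero : isingMzero 0 = -3 / 8 := by norm_num [isingMzero]
/-- **The `𝓑`-residual of a chiral block**: `blockRes h M` is the coefficient of `x^{h+M}` in
`𝓑 k_{2h}`, where `𝓑 = θ(θ-1/2) - xθ(2θ-1/4) + x²(θ-1/8)(θ+3/8)`, `θ = x d/dx`, and
`k_{2h} = Σ_m κ_h(m) x^{h+m}` (`κ = chiralCoeff`):
`𝓑 x^p = p(p-1/2) x^p - p(2p-1/4) x^{p+1} + (p-1/8)(p+3/8) x^{p+2}`. [cite: BelavinPolyakovZamolodchikov1984, App. E] -/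
noncomputable def blockRes (h : ℝ) : ℕ → ℝ
  | 0 => h * (h - 1 / 2) * chiralCoeff h 0
  | 1 => (h + 1) * (h + 1 / 2) * chiralCoeff h 1 - h * (2 * h - 1 / 4) * chiralCoeff h 0
  | (m + 2) => (h + m + 2) * (h + m + 3 / 2) * chiralCoeff h (m + 2)
      - (h + m + 1) * (2 * h + 2 * m + 7 / 4) * chiralCoeff h (m + 1)
      + (h + m + 3 / 8) * (h + m - 1 / 8) * chiralCoeff h m

/-- A block coefficient shifted by `k` and extended by zero: `κ_h(M - k)` for `M ≥ k`, else `0`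
(the coefficient of `x^{h-k+M}` in `x^? k_{2h}` bookkeeping). [folklore] -/
noncomputable def shiftCoeff (h : ℝ) (k M : ℕ) : ℝ :=
  if k ≤ M then chiralCoeff h (M - k) else 0

/-- `shiftCoeff h k M = 0` for `M < k`. [folklore] -/
theorem shiftCoeff_of_lt {h : ℝ} {k M : ℕ} (hM : M < k) : shiftCoeff h k M = 0 := by
  simp [shiftCoeff, Nat.not_le.mpr hM]
/-- `shiftCoeff h k (m + k) = κ_h(m)`. [folklore] -/
theorem shiftCoeff_add (h : ℝ) (k m : ℕ) : shiftCoeff h k (m + k) = chiralCoeff h m := by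
  simp [shiftCoeff]


/-- Evaluation of a shifted coefficient: `shiftCoeff h k (n + k) = κ_h(n)`, with the index equation
supplied explicitly. [folklore] -/
theorem shiftCoeff_eval (h : ℝ) {k M n : ℕ} (e : M = n + k) : shiftCoeff h k M = chiralCoeff h n := by
  subst e
  simp [shiftCoeff]

/-- `κ_{h-2}(2) = (h-2)(h-1)²/(4(2h-3))` for `h ≥ 2`. [folklore] -/
theorem chiralCoeff_two_right_sub {h : ℝ} (hh : 2 ≤ h) :
    chiralCoeff (h - 2) 2 = (h - 2) * (h - 1) ^ 2 / (4 * (2 * h - 3)) := by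
  rw [chiralCoeff_two_right (by linarith : (0:ℝ) ≤ h - 2)]
  ring

/-- `κ_{h-2}(3) = (h-2)(h-1)h²/(24(2h-3))` for `h ≥ 2`. [folklore] -/
theorem chiralCoeff_three_right_sub {h : ℝ} (hh : 2 ≤ h) :
    chiralCoeff (h - 2) 3 = (h - 2) * (h - 1) * h ^ 2 / (24 * (2 * h - 3)) := by
  rw [chiralCoeff_three_right (by linarith : (0:ℝ) ≤ h - 2)]
  ring

/-! ### The three-term identity -/

/-- The rational identity behind the generic case `M = m + 4` (all block coefficients reduced to
`κ_h(m+2)`; `m ≥ 0` may be any real here). [folklore] -/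
theorem blockRes_core_rat {h m : ℝ} (hh : 2 ≤ h) (hm : 0 ≤ m) :
    8 * ((h + m + 4) * (h + m + 7 / 2) *
          ((h + m + 2) ^ 2 / ((m + 3) * (2 * h + m + 2)) * ((h + m + 3) ^ 2 / ((m + 4) * (2 * h + m + 3))))
        - (h + m + 3) * (2 * h + 2 * m + 23 / 4) * ((h + m + 2) ^ 2 / ((m + 3) * (2 * h + m + 2)))
        + (h + m + 19 / 8) * (h + m + 15 / 8))
      - isingMplus h * (4 * (m + 1) * (m + 2) * (2 * h + 1) * (2 * h + 3) /
          (h * (h + 1) * (2 * h + m + 2) * (2 * h + m + 3)))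
      - isingMzero h =
      h * (h - 2) * (h - 1) * (2 * h + m) * (2 * h + m + 1) / ((m + 3) * (m + 4) * (2 * h - 3)) := by
  have hpos : 0 < h := by linarith
  have h1 : 2 * h - 1 ≠ 0 := by intro e; linarith
  have h1' : h * 2 - 1 ≠ 0 := by intro e; linarith
  have h2 : 2 * h - 3 ≠ 0 := by intro e; linarith
  have h2' : h * 2 - 3 ≠ 0 := by intro e; linarith
  unfold isingMplus isingMzero
  field_simp
  ring

/-- The generic case `M = m + 4` for `h ≥ 2`, all but the `k_{2h-4}` term, reduced to `κ_h(m+2)`.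
[cite: BelavinPolyakovZamolodchikov1984, App. E] -/
theorem blockRes_core {h : ℝ} (hh : 2 ≤ h) (m : ℕ) :
    8 * blockRes h (m + 4) - isingMplus h * chiralCoeff (h + 2) m - isingMzero h * chiralCoeff h (m + 2) =
      chiralCoeff h (m + 2) *
        (h * (h - 2) * (h - 1) * (2 * h + m) * (2 * h + m + 1) / ((((m : ℝ) + 3) * ((m : ℝ) + 4)) * (2 * h - 3))) := by
  have hpos : 0 < h := by linarith
  have S1 : chiralCoeff h (m + 3) =
      chiralCoeff h (m + 2) * ((h + m + 2) ^ 2 / (((m : ℝ) + 3) * (2 * h + m + 2))) := by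
    rw [chiralCoeff_succ_ratio hpos (m + 2)]
    push_cast
    ring_nf
  have S2 : chiralCoeff h (m + 4) =
      chiralCoeff h (m + 3) * ((h + m + 3) ^ 2 / (((m : ℝ) + 4) * (2 * h + m + 3))) := by
    rw [show m + 4 = m + 3 + 1 from rfl, chiralCoeff_succ_ratio hpos (m + 3)]
    push_cast
    ring_nf
  have hden : h * (h + 1) * (2 * h + m + 2) * (2 * h + m + 3) ≠ 0 := by positivity
  have S3 : chiralCoeff (h + 2) m = chiralCoeff h (m + 2) *
      (4 * ((m : ℝ) + 1) * ((m : ℝ) + 2) * (2 * h + 1) * (2 * h + 3) /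
        (h * (h + 1) * (2 * h + m + 2) * (2 * h + m + 3))) := by
    rw [mul_div_assoc', eq_div_iff hden]
    exact chiralCoeff_shift_two hpos m
  have e : blockRes h (m + 4) = (h + (m + 2 : ℕ) + 2) * (h + (m + 2 : ℕ) + 3 / 2) * chiralCoeff h (m + 4)
      - (h + (m + 2 : ℕ) + 1) * (2 * h + 2 * (m + 2 : ℕ) + 7 / 4) * chiralCoeff h (m + 3)
      + (h + (m + 2 : ℕ) + 3 / 8) * (h + (m + 2 : ℕ) - 1 / 8) * chiralCoeff h (m + 2) := rfl
  have key := blockRes_core_rat hh (by positivity : (0 : ℝ) ≤ (m : ℝ))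
  rw [e, S2, S1, S3]
  push_cast
  rw [← key]
  ring

/-- The `k_{2h-4}` term for `h ≥ 2`, reduced to `κ_h(m+2)` (at `h = 2` both sides vanish:
`κ_0(m+4) = 0`). [folklore] -/
theorem chiralCoeff_shift_two_down {h : ℝ} (hh : 2 ≤ h) (m : ℕ) :
    isingMminus h * chiralCoeff (h - 2) (m + 4) = chiralCoeff h (m + 2) *
      (h * (h - 2) * (h - 1) * (2 * h + m) * (2 * h + m + 1) / ((((m : ℝ) + 3) * ((m : ℝ) + 4)) * (2 * h - 3))) := by
  rcases hh.lt_or_eq with hgt | heq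
  · have hpos : 0 < h - 2 := by linarith
    have S := chiralCoeff_shift_two hpos (m + 2)
    rw [show h - 2 + 2 = h by ring, show m + 2 + 2 = m + 4 from rfl] at S
    push_cast at S
    have hden : ((m : ℝ) + 3) * ((m : ℝ) + 4) * (2 * h - 3) ≠ 0 := by
      have : (2 * h - 3) ≠ 0 := by intro h0; linarith
      positivity
    unfold isingMminus
    rw [mul_div_assoc', eq_div_iff hden]
    linear_combination (-h) * S
  · rw [← heq]
    norm_num [chiralCoeff_zero_left_succ]

/-- **The three-term action of `𝓑` on `k_{2h}`, coefficientwise, for every `h ≥ 2`**: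
`8 [x^{h+M}] 𝓑 k_{2h} = M₊(h) κ_{h+2}(M-4) + M₀(h) κ_h(M-2) + M₋(h) κ_{h-2}(M)` (coefficients with a
negative index read as `0`). Cases `M = 0, 1, 2, 3` by the closed forms of `κ_h(0..3)`, `M ≥ 4` by
`blockRes_core`. [cite: BelavinPolyakovZamolodchikov1984, App. E] -/
theorem blockRes_three_term {h : ℝ} (hh : 2 ≤ h) (M : ℕ) :
    8 * blockRes h M = isingMplus h * shiftCoeff (h + 2) 4 M + isingMzero h * shiftCoeff h 2 M +
      isingMminus h * chiralCoeff (h - 2) M := by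
  have hpos : 0 < h := by linarith
  have hh' : 0 ≤ h - 2 := by linarith
  have h1 : 2 * h - 1 ≠ 0 := by intro e; linarith
  have h1' : h * 2 - 1 ≠ 0 := by intro e; linarith
  have h2 : 2 * h - 3 ≠ 0 := by intro e; linarith
  have h2' : h * 2 - 3 ≠ 0 := by intro e; linarith
  match M with
  | 0 =>
    simp only [blockRes, chiralCoeff_zero_right, shiftCoeff_of_lt (by norm_num : 0 < 4),
      shiftCoeff_of_lt (by norm_num : 0 < 2), isingMminus]
    ring
  | 1 =>
    simp only [blockRes, chiralCoeff_zero_right, shiftCoeff_of_lt (by norm_num : 1 < 4),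
      shiftCoeff_of_lt (by norm_num : 1 < 2), isingMminus, chiralCoeff_one_right' hpos.le,
      chiralCoeff_one_right' hh']
    ring
  | 2 =>
    rw [shiftCoeff_of_lt (by norm_num : 2 < 4), shiftCoeff_eval h (show 2 = 0 + 2 from rfl)]
    simp only [blockRes, Nat.cast_zero, chiralCoeff_zero_right, chiralCoeff_one_right' hpos.le,
      chiralCoeff_two_right hpos.le, chiralCoeff_two_right_sub hh, isingMminus, isingMzero]
    field_simp
    ring
  | 3 =>
    rw [shiftCoeff_of_lt (by norm_num : 3 < 4), shiftCoeff_eval h (show 3 = 1 + 2 from rfl)]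
    simp only [blockRes, Nat.cast_one, chiralCoeff_one_right' hpos.le, chiralCoeff_two_right hpos.le,
      chiralCoeff_three_right hpos.le, chiralCoeff_three_right_sub hh, isingMminus, isingMzero]
    field_simp
    ring
  | m + 4 =>
    have A := blockRes_core hh m
    have B := chiralCoeff_shift_two_down hh m
    rw [shiftCoeff_eval (h + 2) (show m + 4 = m + 4 from rfl), shiftCoeff_eval h (show m + 4 = (m + 2) + 2 from rfl)]
    linear_combination A - B

/-- **The case `h = 0`** (`k_0 = 1`): `8 𝓑 1 = -(3/8) x² · 1`, i.e. the three-term rule with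
`M₊(0) = M₋(0) = 0`, `M₀(0) = -3/8`. [folklore] -/
theorem blockRes_three_term_zero (M : ℕ) :
    8 * blockRes 0 M = isingMzero 0 * shiftCoeff 0 2 M := by
  rw [isingMzero_zero]
  match M with
  | 0 => simp [blockRes, shiftCoeff]
  | 1 => simp [blockRes, shiftCoeff, chiralCoeff_zero_left_succ]
  | 2 =>
    rw [shiftCoeff_eval 0 (show 2 = 0 + 2 from rfl)]
    simp only [blockRes, Nat.cast_zero, chiralCoeff_zero_right, chiralCoeff_zero_left_succ,
      show (2 : ℕ) = 1 + 1 from rfl]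
    norm_num
  | m + 3 =>
    rw [shiftCoeff_eval 0 (show m + 3 = (m + 1) + 2 from rfl)]
    simp only [blockRes, show m + 1 + 2 = (m + 2) + 1 from rfl, show m + 1 + 1 = (m + 1) + 1 from rfl,
      chiralCoeff_zero_left_succ]
    ring

/-- **The resonant case `h = 1/2`** (the `ε` block `k_1`, where the tridiagonal rules for `y k_1` and
`D k_1` degenerate): `8 𝓑 k_1 = -(9/1024) x² k_5` — no `k_1` and no `k_{-3}` term.
[cite: BelavinPolyakovZamolodchikov1984, App. E] -/
theorem blockRes_three_term_half (M : ℕ) :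
    8 * blockRes (1 / 2) M = -(9 / 1024) * shiftCoeff (5 / 2) 4 M := by
  have hpos : (0 : ℝ) < 1 / 2 := by norm_num
  match M with
  | 0 =>
    rw [shiftCoeff_of_lt (by norm_num : 0 < 4)]
    simp only [blockRes, chiralCoeff_zero_right]
    norm_num
  | 1 =>
    rw [shiftCoeff_of_lt (by norm_num : 1 < 4)]
    simp only [blockRes, chiralCoeff_zero_right, chiralCoeff_one_right' hpos.le]
    norm_num
  | 2 =>
    rw [shiftCoeff_of_lt (by norm_num : 2 < 4)]
    simp only [blockRes, Nat.cast_zero, chiralCoeff_zero_right, chiralCoeff_one_right' hpos.le,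
      chiralCoeff_two_right hpos.le]
    norm_num
  | 3 =>
    rw [shiftCoeff_of_lt (by norm_num : 3 < 4)]
    simp only [blockRes, Nat.cast_one, chiralCoeff_one_right' hpos.le, chiralCoeff_two_right hpos.le,
      chiralCoeff_three_right hpos.le]
    norm_num
  | m + 4 =>
    have S1 : chiralCoeff (1 / 2) (m + 3) =
        chiralCoeff (1 / 2) (m + 2) * ((1 / 2 + m + 2) ^ 2 / (((m : ℝ) + 3) * (2 * (1 / 2) + m + 2))) := by
      rw [chiralCoeff_succ_ratio hpos (m + 2)]
      push_cast
      ring_nf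
    have S2 : chiralCoeff (1 / 2) (m + 4) =
        chiralCoeff (1 / 2) (m + 3) * ((1 / 2 + m + 3) ^ 2 / (((m : ℝ) + 4) * (2 * (1 / 2) + m + 3))) := by
      rw [show m + 4 = m + 3 + 1 from rfl, chiralCoeff_succ_ratio hpos (m + 3)]
      push_cast
      ring_nf
    have hden : (1 / 2 : ℝ) * (1 / 2 + 1) * (2 * (1 / 2) + m + 2) * (2 * (1 / 2) + m + 3) ≠ 0 := by
      positivity
    have S3 : chiralCoeff (5 / 2) m = chiralCoeff (1 / 2) (m + 2) *
        (4 * ((m : ℝ) + 1) * ((m : ℝ) + 2) * (2 * (1 / 2) + 1) * (2 * (1 / 2) + 3) /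
          ((1 / 2 : ℝ) * (1 / 2 + 1) * (2 * (1 / 2) + m + 2) * (2 * (1 / 2) + m + 3))) := by
      rw [mul_div_assoc', eq_div_iff hden, show (5 / 2 : ℝ) = 1 / 2 + 2 by norm_num]
      exact chiralCoeff_shift_two hpos m
    have e : blockRes (1 / 2) (m + 4) =
        (1 / 2 + (m + 2 : ℕ) + 2) * (1 / 2 + (m + 2 : ℕ) + 3 / 2) * chiralCoeff (1 / 2) (m + 4)
        - (1 / 2 + (m + 2 : ℕ) + 1) * (2 * (1 / 2) + 2 * (m + 2 : ℕ) + 7 / 4) * chiralCoeff (1 / 2) (m + 3)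
        + (1 / 2 + (m + 2 : ℕ) + 3 / 8) * (1 / 2 + (m + 2 : ℕ) - 1 / 8) * chiralCoeff (1 / 2) (m + 2) := rfl
    rw [shiftCoeff_eval (5 / 2) (show m + 4 = m + 4 from rfl), e, S2, S1, S3]
    push_cast
    field_simp
    ring

end Summit.CriticalPhenomena.Ising3D.Control2D
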